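import Mathlib
import HarnessLib
import Literature.Analysis.FluidPDE.AxisymmetricEuler
import Literature.Analysis.FluidPDE.SwirlTransportProofs
import Literature.Analysis.FluidPDE.ClassicalSolution
import Literature.Analysis.FluidPDE.SelfSimilar
import Literature.Analysis.FluidPDE.LocalTypeI
import Literature.Analysis.FluidPDE.VectorCalculus
import Literature.Analysis.FluidPDE.TypeIAncientMild
import Literature.Analysis.UnboundedOperators.HeatKernel
import Summits.NavierStokesRegularity.NavierStokesRegularity.Theorems.LocalSineTubeDoorProfileAlignedWindowRigidityAncient
import Summits.NavierStokesRegularity.NavierStokesRegularity.Theorems.PoloidalWindowDoorPoloidalWindowRigidityWindow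
import Summits.NavierStokesRegularity.NavierStokesRegularity.Theorems.PoloidalWindowDoorPoloidalWindowRigidityFlat
import Summits.NavierStokesRegularity.NavierStokesRegularity.Theorems.PoloidalWindowDoorPoloidalWindowRigidityDegenerate
import Summits.NavierStokesRegularity.NavierStokesRegularity.Theorems.PoloidalWindowDoorPoloidalWindowRigidityClassRate
import Summits.NavierStokesRegularity.NavierStokesRegularity.Theorems.PoloidalWindowDoorPoloidalWindowRigidityScrewGlue

/-!
# Route `PoloidalWindowDoor`, crux `PoloidalWindowRigidity` (K2, stmt-NavierStokesRegularity-19708), line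
# `slicesharp-screw` — stub S1 `stub_screwStratum` ASSEMBLED modulo the registered support stubs L2 / L3 / L4

Cell ns-regularity-ideate, seat ns-poloidal-K2-p3 (stub-worker; `--supports` the crux, `--as helper`).  Companion of
`…ScrewGlue` (kinematics of screw-invariant fields, the transport law of the screw component `θ = v·h`,
`h = e₃ + κ J(· − c)`, about a general vertical axis, joint regularity of `θ`).  Here the three registered support
stubs of the lead's skeleton `slicesharp-screw` are taken AS HYPOTHESES IN THEIR REGISTERED SHAPE and S1 is derived:

* `screwComponent_equation_of_L3` — L4's pointwise equation `∂ₜθ + (v·∇)θ − Δθ = src(t)` with the INTRINSIC source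
  `src t = (∂ₜθ + v·∇θ − Δθ)(t, c)`: on each window `(2t, 0)` both sides are `−h·∇p` (`…ScrewGlue`), L3 makes
  `⟪∇p(t,·), h⟫` spatially constant, `derivWithin = deriv` on the open window — no window-pressure bookkeeping survives;
* `screwComponent_slope_of_L2` — L4's slope hypothesis `|θ(t,x) − θ(t,c)| ≤ ε(t)‖x − c‖`, `ε(t) = C₂/(−t)`, from L2
  with the vorticity rate of `…ClassRate.exists_curl_rate_of_class` (p450704);
* `continuousOn_rate` / `tendsto_rate_mul_sqrt` — `ε` is continuous on `(−∞,0)` and `ε(t)√(−t) = C₂/√(−t) → 0` as `t → −∞`;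
* `screwStratum_of_L2_L3_L4` — **S1 `stub_screwStratum` VERBATIM, from the registered signatures of L2, L3, L4**
  (then `θ` is constant on slices by L4, every slice is irrotational by `…ScrewGlue.curl_eq_zero_of_screwComponent_const`,
  and `…Degenerate.eq_zero_of_irrotational` ends); `not_backwardSingular_screwStratum_of_L2_L3_L4`.

So S1 closes in ONE LINE once L2, L3, L4 land, and their registered signatures are hereby kernel-checked to FIT the
assembly (no `stub-misstated` surprises at assembly time).

WHAT THIS IS NOT: not a claim about Navier–Stokes regularity and not the open residue S2 — kernel-checked assembly of
one stratum of a door route's crux modulo three registered stubs (bears_on LADDER-NS N0, rung N0-LocalTubeDoorPoloidal).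
-/

noncomputable section

-- the summit and its single sub-problem share the name (CONVENTIONS §1), as in every Theorems file
set_option linter.dupNamespace false

namespace Summit.NavierStokesRegularity.NavierStokesRegularity.Theorems.PoloidalWindowDoorPoloidalWindowRigidityScrewAssembly

open MeasureTheory Set Function Filter Topology TopologicalSpace Metric InnerProductSpace
open scoped RealInnerProductSpace InnerProductSpace Laplacian ContDiff
open Literature.Analysis Literature.Analysis.FluidPDE
open Summit.NavierStokesRegularity.NavierStokesRegularity.Theorems.LocalSineTubeDoorProfileAlignedWindowRigidityAncient
open Summit.NavierStokesRegularity.NavierStokesRegularity.Theorems.PoloidalWindowDoorPoloidalWindowRigidityWindow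
open Summit.NavierStokesRegularity.NavierStokesRegularity.Theorems.PoloidalWindowDoorPoloidalWindowRigidityFlat
open Summit.NavierStokesRegularity.NavierStokesRegularity.Theorems.PoloidalWindowDoorPoloidalWindowRigidityDegenerate
open Summit.NavierStokesRegularity.NavierStokesRegularity.Theorems.PoloidalWindowDoorPoloidalWindowRigidityClassRate
open Summit.NavierStokesRegularity.NavierStokesRegularity.Theorems.PoloidalWindowDoorPoloidalWindowRigidityScrewGlue

variable {C : ℝ} {v : ℝ → EuclideanSpace ℝ (Fin 3) → EuclideanSpace ℝ (Fin 3)}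

/-- **L4's equation for `θ = v·h`, from L3 (taken as a hypothesis in its registered shape).**  Along a poloidal profile
of the class that is screw-invariant (pitch `κ`, axis through `c`) on every slice, `∂ₜθ + (v·∇)θ − Δθ` at `(t, x)`
equals its value at `(t, c)` — a source depending on time only: on the window `(2t, 0)` both equal `−h·∇p`
(`screwComponent_transport_of_class_centre`), L3 makes `⟪∇p(t,·), h⟫` spatially constant, and `derivWithin = deriv`
on the open window. -/
theorem screwComponent_equation_of_L3
    (hL3 : ∀ (S : Set ℝ), IsOpen S → ∀ (ν : ℝ)
      (u : ℝ → EuclideanSpace ℝ (Fin 3) → EuclideanSpace ℝ (Fin 3)) (p : ℝ → EuclideanSpace ℝ (Fin 3) → ℝ),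
      Literature.Analysis.FluidPDE.IsClassicalNSSolutionOn S ν 0 u p →
      ∀ (κ : ℝ) (c : EuclideanSpace ℝ (Fin 3)),
      (∀ t ∈ S, ∀ (a : ℝ) (y : EuclideanSpace ℝ (Fin 3)),
        u t (c + Literature.Analysis.FluidPDE.rotZ (κ * a) (y - c) + a • EuclideanSpace.single 2 (1 : ℝ)) =
          Literature.Analysis.FluidPDE.rotZ (κ * a) (u t y)) →
      ∀ t ∈ S, ∀ x : EuclideanSpace ℝ (Fin 3),
        ⟪gradient (p t) x, (EuclideanSpace.single 2 (1 : ℝ) : EuclideanSpace ℝ (Fin 3)) + κ • Literature.Analysis.FluidPDE.rotGen (x - c)⟫_ℝ =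
          ⟪gradient (p t) c, (EuclideanSpace.single 2 (1 : ℝ) : EuclideanSpace ℝ (Fin 3))⟫_ℝ)
    (hrate : HasTypeITimeDecay C v)
    (hcont : ContinuousOn (uncurry v) (Iio (0 : ℝ) ×ˢ univ))
    (hmild : ∀ s t : ℝ, s < t → t < 0 → ∀ x,
      v t x = UnboundedOperators.heatExtension (v s) (t - s) x - oseenDuhamel 1 s v v t x)
    (hdiv : ∀ t < 0, VectorCalculus.IsDivFree (v t))
    (hpol : ∀ s < 0, ∀ y, ⟪curl (v s) y, EuclideanSpace.single 2 (1 : ℝ)⟫_ℝ = 0)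
    {κ : ℝ} {c : EuclideanSpace ℝ (Fin 3)}
    (hinv : ∀ s < 0, ∀ (a : ℝ) (y : EuclideanSpace ℝ (Fin 3)),
      v s (c + rotZ (κ * a) (y - c) + a • EuclideanSpace.single 2 (1 : ℝ)) = rotZ (κ * a) (v s y)) :
    ∀ t < 0, ∀ x,
      deriv (fun τ => ⟪v τ x, (EuclideanSpace.single 2 (1 : ℝ) : EuclideanSpace ℝ (Fin 3)) + κ • rotGen (x - c)⟫_ℝ) t
        + fderiv ℝ (fun y => ⟪v t y, (EuclideanSpace.single 2 (1 : ℝ) : EuclideanSpace ℝ (Fin 3)) + κ • rotGen (y - c)⟫_ℝ) x (v t x)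
        - (Δ (fun y => ⟪v t y, (EuclideanSpace.single 2 (1 : ℝ) : EuclideanSpace ℝ (Fin 3)) + κ • rotGen (y - c)⟫_ℝ)) x =
      deriv (fun τ => ⟪v τ c, (EuclideanSpace.single 2 (1 : ℝ) : EuclideanSpace ℝ (Fin 3)) + κ • rotGen (c - c)⟫_ℝ) t
        + fderiv ℝ (fun y => ⟪v t y, (EuclideanSpace.single 2 (1 : ℝ) : EuclideanSpace ℝ (Fin 3)) + κ • rotGen (y - c)⟫_ℝ) c (v t c)
        - (Δ (fun y => ⟪v t y, (EuclideanSpace.single 2 (1 : ℝ) : EuclideanSpace ℝ (Fin 3)) + κ • rotGen (y - c)⟫_ℝ)) c := by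
  intro t ht x
  have h2t : 2 * t < 0 := by linarith
  have htS : t ∈ Ioo (2 * t) 0 := ⟨by linarith, ht⟩
  obtain ⟨p, hns, hwin⟩ := screwComponent_transport_of_class_centre hrate hcont hmild hdiv hpol κ c h2t
  have hx := hwin t htS x
  have hc := hwin t htS c
  rw [derivWithin_of_isOpen isOpen_Ioo htS] at hx hc
  have hpx := hL3 (Ioo (2 * t) 0) isOpen_Ioo 1 v p hns κ c (fun s hs a y => hinv s hs.2 a y) t htS x
  have hpc := hL3 (Ioo (2 * t) 0) isOpen_Ioo 1 v p hns κ c (fun s hs a y => hinv s hs.2 a y) t htS c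
  rw [hx, hc, hpx, hpc]

/-- **L4's slope hypothesis for `θ = v·h`, from L2 (taken as a hypothesis in its registered shape) and a vorticity
rate `‖curl v(t)‖ ≤ C₂/(−t)` (tree `…ClassRate.exists_curl_rate_of_class`)**: `|θ(t,x) − θ(t,c)| ≤ (C₂/(−t))‖x − c‖`. -/
theorem screwComponent_slope_of_L2
    (hL2 : ∀ (u : EuclideanSpace ℝ (Fin 3) → EuclideanSpace ℝ (Fin 3)), ContDiff ℝ 1 u →
      (∀ y, Literature.Analysis.FluidPDE.curl u y 2 = 0) →
      ∀ (κ : ℝ) (c : EuclideanSpace ℝ (Fin 3)),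
      (∀ (a : ℝ) (y : EuclideanSpace ℝ (Fin 3)),
        u (c + Literature.Analysis.FluidPDE.rotZ (κ * a) (y - c) + a • EuclideanSpace.single 2 (1 : ℝ)) =
          Literature.Analysis.FluidPDE.rotZ (κ * a) (u y)) →
      ∀ (B : ℝ), 0 ≤ B → (∀ y, ‖Literature.Analysis.FluidPDE.curl u y‖ ≤ B) →
      ∀ y, |⟪u y, (EuclideanSpace.single 2 (1 : ℝ) : EuclideanSpace ℝ (Fin 3)) + κ • Literature.Analysis.FluidPDE.rotGen (y - c)⟫_ℝ
            - ⟪u c, (EuclideanSpace.single 2 (1 : ℝ) : EuclideanSpace ℝ (Fin 3))⟫_ℝ| ≤ B * ‖y - c‖)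
    (hrate : HasTypeITimeDecay C v)
    (hcont : ContinuousOn (uncurry v) (Iio (0 : ℝ) ×ˢ univ))
    (hmild : ∀ s t : ℝ, s < t → t < 0 → ∀ x,
      v t x = UnboundedOperators.heatExtension (v s) (t - s) x - oseenDuhamel 1 s v v t x)
    (hpol : ∀ s < 0, ∀ y, ⟪curl (v s) y, EuclideanSpace.single 2 (1 : ℝ)⟫_ℝ = 0)
    {κ : ℝ} {c : EuclideanSpace ℝ (Fin 3)}
    (hinv : ∀ s < 0, ∀ (a : ℝ) (y : EuclideanSpace ℝ (Fin 3)),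
      v s (c + rotZ (κ * a) (y - c) + a • EuclideanSpace.single 2 (1 : ℝ)) = rotZ (κ * a) (v s y))
    {C₂ : ℝ} (hC₂ : ∀ t < 0, ∀ y, ‖curl (v t) y‖ ≤ C₂ / (-t)) :
    ∀ t < 0, ∀ x,
      |⟪v t x, (EuclideanSpace.single 2 (1 : ℝ) : EuclideanSpace ℝ (Fin 3)) + κ • rotGen (x - c)⟫_ℝ
          - ⟪v t c, (EuclideanSpace.single 2 (1 : ℝ) : EuclideanSpace ℝ (Fin 3)) + κ • rotGen (c - c)⟫_ℝ| ≤
        C₂ / (-t) * ‖x - c‖ := by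
  intro t ht x
  have hbdd := bdd_of_hasTypeITimeDecay hrate
  have hu : ContDiff ℝ 1 (v t) := (analyticOnNhd_slice hcont hbdd hmild ht).contDiff
  have hpol' : ∀ y, curl (v t) y 2 = 0 := fun y => by
    have h1 := hpol t ht y
    rwa [EuclideanSpace.inner_single_right, one_mul, conj_trivial] at h1
  have hB : 0 ≤ C₂ / (-t) := (norm_nonneg _).trans (hC₂ t ht c)
  rw [screwField_centre_self]
  exact hL2 (v t) hu hpol' κ c (hinv t ht) (C₂ / (-t)) hB (hC₂ t ht) x

/-- **The rate `ε(t) = C₂/(−t)` has `ε(t)√(−t) = C₂/√(−t) → 0` as `t → −∞`** (L4's decay hypothesis). -/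
theorem tendsto_rate_mul_sqrt (C₂ : ℝ) :
    Tendsto (fun t : ℝ => C₂ / (-t) * Real.sqrt (-t)) atBot (𝓝 0) := by
  have h1 : Tendsto (fun t : ℝ => Real.sqrt (-t)) atBot atTop :=
    Real.tendsto_sqrt_atTop.comp tendsto_neg_atBot_atTop
  have h2 : Tendsto (fun t : ℝ => C₂ / Real.sqrt (-t)) atBot (𝓝 0) := tendsto_const_nhds.div_atTop h1
  refine h2.congr' ?_
  filter_upwards [eventually_lt_atBot (0 : ℝ)] with t ht
  have hs : 0 < Real.sqrt (-t) := Real.sqrt_pos.2 (neg_pos.2 ht)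
  have hst : Real.sqrt (-t) * Real.sqrt (-t) = -t := Real.mul_self_sqrt (neg_pos.2 ht).le
  calc C₂ / Real.sqrt (-t) = C₂ * Real.sqrt (-t) / (Real.sqrt (-t) * Real.sqrt (-t)) :=
        (mul_div_mul_right C₂ (Real.sqrt (-t)) hs.ne').symm
    _ = C₂ / (-t) * Real.sqrt (-t) := by rw [hst, div_mul_eq_mul_div]

/-- **The rate `ε(t) = C₂/(−t)` is continuous on `(−∞, 0)`** (L4's continuity hypothesis). -/
theorem continuousOn_rate (C₂ : ℝ) : ContinuousOn (fun t : ℝ => C₂ / (-t)) (Iio 0) :=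
  continuousOn_const.div continuousOn_id.neg fun _ ht => neg_ne_zero.2 (ne_of_lt ht)

/-! ### S1 assembled: the screw-symmetric stratum is empty, modulo L2, L3, L4 -/

/-- **STUB S1 `stub_screwStratum` FROM THE REGISTERED STUBS L2, L3, L4 (their signatures verbatim as hypotheses).**
A profile of the route's Type-I class, poloidal along `e₃`, invariant on every slice under the screw motions of some
pitch `κ ≠ 0` about some vertical axis, vanishes identically.  Proof (CENSUS-K2G §12 Cor. B): for `θ = v·h`,
`h = e₃ + κJ(· − c)`: joint `C²` regularity (`contDiffOn_screwComponent`); the transported–diffused equation with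
time-only source (`screwComponent_equation_of_L3`); decaying slope `ε(t) = C₂/(−t)` (`screwComponent_slope_of_L2`,
tree `exists_curl_rate_of_class`, `tendsto_rate_mul_sqrt`); L4 makes `θ` constant on every slice; the kinematic
identity makes every slice irrotational (`curl_eq_zero_of_screwComponent_const`); `…Degenerate.eq_zero_of_irrotational`. -/
theorem screwStratum_of_L2_L3_L4
    (hL2 : ∀ (u : EuclideanSpace ℝ (Fin 3) → EuclideanSpace ℝ (Fin 3)), ContDiff ℝ 1 u →
      (∀ y, Literature.Analysis.FluidPDE.curl u y 2 = 0) →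
      ∀ (κ : ℝ) (c : EuclideanSpace ℝ (Fin 3)),
      (∀ (a : ℝ) (y : EuclideanSpace ℝ (Fin 3)),
        u (c + Literature.Analysis.FluidPDE.rotZ (κ * a) (y - c) + a • EuclideanSpace.single 2 (1 : ℝ)) =
          Literature.Analysis.FluidPDE.rotZ (κ * a) (u y)) →
      ∀ (B : ℝ), 0 ≤ B → (∀ y, ‖Literature.Analysis.FluidPDE.curl u y‖ ≤ B) →
      ∀ y, |⟪u y, (EuclideanSpace.single 2 (1 : ℝ) : EuclideanSpace ℝ (Fin 3)) + κ • Literature.Analysis.FluidPDE.rotGen (y - c)⟫_ℝ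
            - ⟪u c, (EuclideanSpace.single 2 (1 : ℝ) : EuclideanSpace ℝ (Fin 3))⟫_ℝ| ≤ B * ‖y - c‖)
    (hL3 : ∀ (S : Set ℝ), IsOpen S → ∀ (ν : ℝ)
      (u : ℝ → EuclideanSpace ℝ (Fin 3) → EuclideanSpace ℝ (Fin 3)) (p : ℝ → EuclideanSpace ℝ (Fin 3) → ℝ),
      Literature.Analysis.FluidPDE.IsClassicalNSSolutionOn S ν 0 u p →
      ∀ (κ : ℝ) (c : EuclideanSpace ℝ (Fin 3)),
      (∀ t ∈ S, ∀ (a : ℝ) (y : EuclideanSpace ℝ (Fin 3)),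
        u t (c + Literature.Analysis.FluidPDE.rotZ (κ * a) (y - c) + a • EuclideanSpace.single 2 (1 : ℝ)) =
          Literature.Analysis.FluidPDE.rotZ (κ * a) (u t y)) →
      ∀ t ∈ S, ∀ x : EuclideanSpace ℝ (Fin 3),
        ⟪gradient (p t) x, (EuclideanSpace.single 2 (1 : ℝ) : EuclideanSpace ℝ (Fin 3)) + κ • Literature.Analysis.FluidPDE.rotGen (x - c)⟫_ℝ =
          ⟪gradient (p t) c, (EuclideanSpace.single 2 (1 : ℝ) : EuclideanSpace ℝ (Fin 3))⟫_ℝ)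
    (hL4 : ∀ (C : ℝ) (v : ℝ → EuclideanSpace ℝ (Fin 3) → EuclideanSpace ℝ (Fin 3)),
      Literature.Analysis.FluidPDE.HasTypeITimeDecay C v →
      ContinuousOn (Function.uncurry v) (Set.Iio (0 : ℝ) ×ˢ Set.univ) →
      (∀ s t : ℝ, s < t → t < 0 → ∀ x, v t x =
        Literature.Analysis.UnboundedOperators.heatExtension (v s) (t - s) x -
          Literature.Analysis.FluidPDE.oseenDuhamel 1 s v v t x) →
      (∀ t < 0, Literature.Analysis.FluidPDE.VectorCalculus.IsDivFree (v t)) →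
      ∀ (θ : ℝ → EuclideanSpace ℝ (Fin 3) → ℝ) (src : ℝ → ℝ) (x₀ : EuclideanSpace ℝ (Fin 3)) (ε : ℝ → ℝ),
      ContDiffOn ℝ 2 (Function.uncurry θ) (Set.Iio (0 : ℝ) ×ˢ Set.univ) →
      (∀ t < 0, ∀ x, deriv (fun τ => θ τ x) t + fderiv ℝ (θ t) x (v t x) - (Δ (θ t)) x = src t) →
      (∀ t < 0, ∀ x, |θ t x - θ t x₀| ≤ ε t * ‖x - x₀‖) →
      ContinuousOn ε (Set.Iio 0) →
      Filter.Tendsto (fun t => ε t * Real.sqrt (-t)) Filter.atBot (nhds 0) →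
      ∀ t < 0, ∀ x, θ t x = θ t x₀)
    :
    ∀ (C : ℝ) (v : ℝ → EuclideanSpace ℝ (Fin 3) → EuclideanSpace ℝ (Fin 3)),
      Literature.Analysis.FluidPDE.HasTypeITimeDecay C v →
      ContinuousOn (Function.uncurry v) (Set.Iio (0 : ℝ) ×ˢ Set.univ) →
      (∀ s t : ℝ, s < t → t < 0 → ∀ x, v t x =
        Literature.Analysis.UnboundedOperators.heatExtension (v s) (t - s) x -
          Literature.Analysis.FluidPDE.oseenDuhamel 1 s v v t x) →
      (∀ t < 0, Literature.Analysis.FluidPDE.VectorCalculus.IsDivFree (v t)) →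
      (∀ s < 0, ∀ y, ⟪Literature.Analysis.FluidPDE.curl (v s) y, EuclideanSpace.single 2 1⟫_ℝ = 0) →
      (∃ κ : ℝ, κ ≠ 0 ∧ ∃ c : EuclideanSpace ℝ (Fin 3), ∀ s < 0, ∀ (a : ℝ) (y : EuclideanSpace ℝ (Fin 3)),
        v s (c + Literature.Analysis.FluidPDE.rotZ (κ * a) (y - c) + a • EuclideanSpace.single 2 (1 : ℝ)) =
          Literature.Analysis.FluidPDE.rotZ (κ * a) (v s y)) →
      ∀ t < 0, ∀ x, v t x = 0
    := by
  intro C v hrate hcont hmild hdiv hpol hscrew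
  obtain ⟨κ, -, c, hinv⟩ := hscrew
  obtain ⟨C₂, hC₂⟩ := exists_curl_rate_of_class hrate hcont hmild
  have hbdd := bdd_of_hasTypeITimeDecay hrate
  -- θ = v·h is constant on every slice (L4 with the inputs above)
  have hconst := hL4 C v hrate hcont hmild hdiv
    (fun t y => ⟪v t y, (EuclideanSpace.single 2 (1 : ℝ) : EuclideanSpace ℝ (Fin 3)) + κ • rotGen (y - c)⟫_ℝ)
    (fun t => deriv (fun τ => ⟪v τ c, (EuclideanSpace.single 2 (1 : ℝ) : EuclideanSpace ℝ (Fin 3)) + κ • rotGen (c - c)⟫_ℝ) t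
        + fderiv ℝ (fun y => ⟪v t y, (EuclideanSpace.single 2 (1 : ℝ) : EuclideanSpace ℝ (Fin 3)) + κ • rotGen (y - c)⟫_ℝ) c (v t c)
        - (Δ (fun y => ⟪v t y, (EuclideanSpace.single 2 (1 : ℝ) : EuclideanSpace ℝ (Fin 3)) + κ • rotGen (y - c)⟫_ℝ)) c)
    c (fun t => C₂ / (-t))
    (contDiffOn_screwComponent hrate hcont hmild hdiv κ c)
    (screwComponent_equation_of_L3 hL3 hrate hcont hmild hdiv hpol hinv)
    (screwComponent_slope_of_L2 hL2 hrate hcont hmild hpol hinv hC₂)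
    (continuousOn_rate C₂) (tendsto_rate_mul_sqrt C₂)
  -- hence every slice is irrotational
  have hirr : ∀ s < 0, ∀ y, curl (v s) y = 0 := by
    intro s hs
    have hu : ContDiff ℝ 1 (v s) := (analyticOnNhd_slice hcont hbdd hmild hs).contDiff
    have hpol' : ∀ y, curl (v s) y 2 = 0 := fun y => by
      have h1 := hpol s hs y
      rwa [EuclideanSpace.inner_single_right, one_mul, conj_trivial] at h1
    refine curl_eq_zero_of_screwComponent_const hu hpol' (hinv s hs) fun y => ?_
    have h := hconst s hs y
    rwa [screwField_centre_self] at h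
  exact eq_zero_of_irrotational hrate hcont hmild hdiv hirr

/-- **S1, not backward-singular**: the screw-symmetric stratum of the residue is settled modulo L2, L3, L4. -/
theorem not_backwardSingular_screwStratum_of_L2_L3_L4
    (hL2 : ∀ (u : EuclideanSpace ℝ (Fin 3) → EuclideanSpace ℝ (Fin 3)), ContDiff ℝ 1 u →
      (∀ y, Literature.Analysis.FluidPDE.curl u y 2 = 0) →
      ∀ (κ : ℝ) (c : EuclideanSpace ℝ (Fin 3)),
      (∀ (a : ℝ) (y : EuclideanSpace ℝ (Fin 3)),
        u (c + Literature.Analysis.FluidPDE.rotZ (κ * a) (y - c) + a • EuclideanSpace.single 2 (1 : ℝ)) =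
          Literature.Analysis.FluidPDE.rotZ (κ * a) (u y)) →
      ∀ (B : ℝ), 0 ≤ B → (∀ y, ‖Literature.Analysis.FluidPDE.curl u y‖ ≤ B) →
      ∀ y, |⟪u y, (EuclideanSpace.single 2 (1 : ℝ) : EuclideanSpace ℝ (Fin 3)) + κ • Literature.Analysis.FluidPDE.rotGen (y - c)⟫_ℝ
            - ⟪u c, (EuclideanSpace.single 2 (1 : ℝ) : EuclideanSpace ℝ (Fin 3))⟫_ℝ| ≤ B * ‖y - c‖)
    (hL3 : ∀ (S : Set ℝ), IsOpen S → ∀ (ν : ℝ)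
      (u : ℝ → EuclideanSpace ℝ (Fin 3) → EuclideanSpace ℝ (Fin 3)) (p : ℝ → EuclideanSpace ℝ (Fin 3) → ℝ),
      Literature.Analysis.FluidPDE.IsClassicalNSSolutionOn S ν 0 u p →
      ∀ (κ : ℝ) (c : EuclideanSpace ℝ (Fin 3)),
      (∀ t ∈ S, ∀ (a : ℝ) (y : EuclideanSpace ℝ (Fin 3)),
        u t (c + Literature.Analysis.FluidPDE.rotZ (κ * a) (y - c) + a • EuclideanSpace.single 2 (1 : ℝ)) =
          Literature.Analysis.FluidPDE.rotZ (κ * a) (u t y)) →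
      ∀ t ∈ S, ∀ x : EuclideanSpace ℝ (Fin 3),
        ⟪gradient (p t) x, (EuclideanSpace.single 2 (1 : ℝ) : EuclideanSpace ℝ (Fin 3)) + κ • Literature.Analysis.FluidPDE.rotGen (x - c)⟫_ℝ =
          ⟪gradient (p t) c, (EuclideanSpace.single 2 (1 : ℝ) : EuclideanSpace ℝ (Fin 3))⟫_ℝ)
    (hL4 : ∀ (C : ℝ) (v : ℝ → EuclideanSpace ℝ (Fin 3) → EuclideanSpace ℝ (Fin 3)),
      Literature.Analysis.FluidPDE.HasTypeITimeDecay C v →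
      ContinuousOn (Function.uncurry v) (Set.Iio (0 : ℝ) ×ˢ Set.univ) →
      (∀ s t : ℝ, s < t → t < 0 → ∀ x, v t x =
        Literature.Analysis.UnboundedOperators.heatExtension (v s) (t - s) x -
          Literature.Analysis.FluidPDE.oseenDuhamel 1 s v v t x) →
      (∀ t < 0, Literature.Analysis.FluidPDE.VectorCalculus.IsDivFree (v t)) →
      ∀ (θ : ℝ → EuclideanSpace ℝ (Fin 3) → ℝ) (src : ℝ → ℝ) (x₀ : EuclideanSpace ℝ (Fin 3)) (ε : ℝ → ℝ),
      ContDiffOn ℝ 2 (Function.uncurry θ) (Set.Iio (0 : ℝ) ×ˢ Set.univ) →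
      (∀ t < 0, ∀ x, deriv (fun τ => θ τ x) t + fderiv ℝ (θ t) x (v t x) - (Δ (θ t)) x = src t) →
      (∀ t < 0, ∀ x, |θ t x - θ t x₀| ≤ ε t * ‖x - x₀‖) →
      ContinuousOn ε (Set.Iio 0) →
      Filter.Tendsto (fun t => ε t * Real.sqrt (-t)) Filter.atBot (nhds 0) →
      ∀ t < 0, ∀ x, θ t x = θ t x₀)
    (hrate : HasTypeITimeDecay C v)
    (hcont : ContinuousOn (uncurry v) (Iio (0 : ℝ) ×ˢ univ))
    (hmild : ∀ s t : ℝ, s < t → t < 0 → ∀ x,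
      v t x = UnboundedOperators.heatExtension (v s) (t - s) x - oseenDuhamel 1 s v v t x)
    (hdiv : ∀ t < 0, VectorCalculus.IsDivFree (v t))
    (hpol : ∀ s < 0, ∀ y, ⟪curl (v s) y, EuclideanSpace.single 2 (1 : ℝ)⟫_ℝ = 0)
    (hscrew : ∃ κ : ℝ, κ ≠ 0 ∧ ∃ c : EuclideanSpace ℝ (Fin 3), ∀ s < 0, ∀ (a : ℝ) (y : EuclideanSpace ℝ (Fin 3)),
        v s (c + rotZ (κ * a) (y - c) + a • EuclideanSpace.single 2 (1 : ℝ)) = rotZ (κ * a) (v s y)) :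
    ¬ IsBackwardSingularPoint v 0 :=
  not_backwardSingular_of_zero (screwStratum_of_L2_L3_L4 hL2 hL3 hL4 C v hrate hcont hmild hdiv hpol hscrew)

end Summit.NavierStokesRegularity.NavierStokesRegularity.Theorems.PoloidalWindowDoorPoloidalWindowRigidityScrewAssembly

end
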